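import Literature.Computability.Complexity.MurrayWilliams2018
import Literature.Computability.Complexity.ACC0SubsetPPoly
import Literature.Computability.Complexity.DTIMESubsetNTIME
import Literature.Computability.Complexity.QuasiPolyClock
import HarnessLib

/-!
# Murray–Williams' `NQP ⊄ ACC⁰` from the printed Theorem 1.3: pinning and `P ⊆ NQP`

Companion of `MurrayWilliams2018.lean` (which decomposes Murray–Williams 2018, Thm. 1.3 —
the named fact `MurrayWilliams2018_NTIME_not_depth_ACC` of `CircuitLowerBounds.lean` — into the
connection Thm. 1.2 and the `ACC`-SAT algorithm Thm. 5.1). This file PROVES that the headline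
named fact
`Literature.Computability.Complexity.MurrayWilliams2018_NQP_not_subset_ACC0 : ¬ (NQP ⊆ ACC0)`
(C. D. Murray, R. R. Williams, STOC 2018, §1.1) follows from the printed Theorem 1.3 itself, up to
one folklore inclusion of nondeterministic time classes. So far the tree derived the headline from
the §1.1 form `MurrayWilliams2018_NQP_not_ACC`, in which ONE language of `NQP` is hard for all
depths and moduli at once; Theorem 1.3 only provides, for every depth `d` and modulus `m`, a hard
language depending on `(d, m)`. The quantifier swap is the PINNING argument of Williams 2014,
Lemma 5.1 ("if `P` has non-uniform `C` circuits … every … circuit family has an equivalent …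
circuit family in `C`", via the `C`-circuits of the single problem CIRCUIT-EVAL; Murray–Williams
use the same device with `EVAL-GATE`, p. 14), proved here in the sharp form needed:

* `exists_pinned_of_P_subset_ACC0` — **proved**: if `P ⊆ ACC⁰` then there are ONE modulus
  `m ≥ 2` and ONE depth `d` such that every language of `P/poly` has depth-`d` polynomial-size
  `AC⁰[m]` circuits (hard-wire the description `desc Cₙ` of the `n`-th `B₂`-circuit into the
  `AC⁰[m]` circuits of `CircEval.EvalLang ∈ P`, `CircuitEval.lean`, by `Circuit.exists_hardwire`
  of `Williams2014.lean`);
* `P_subset_NTIME_two_pow_log_sq`, `P_subset_NQP` — **proved**: `P ⊆ NTIME(2^{(log₂ n)²}) ⊆ NQP`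
  (a deterministic decider is a verifier discarding its certificate,
  `DTIME_subset_NTIME_of_dominated` of `DTIMESubsetNTIME.lean`, and `nᴷ ≤ 2^{(log₂ n)²}`
  eventually, `pow_le_two_pow_log_sq` of `Williams2014.lean`);
* `NTIME_powLog_subset_NQP` — the folklore inclusion `NTIME(n^{(log₂ n)ᵉ}) ⊆ NQP` for every `e`
  (named glue fact: in the tree's one-constant verifier form of `NTIME` this monotonicity is a
  machine construction — a clock for `n^{(log₂ n)ᵉ}`, cf. `NTIMEPadding.lean` — left to a
  companion file);
* `MurrayWilliams2018_NTIME_not_depth_ACC.not_subset_ACC0` — **proved**: Thm. 1.3 (at `k = 1`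
  and the pinned `(d, m)`) and the glue fact give `MurrayWilliams2018_NQP_not_subset_ACC0`;
  `MurrayWilliams2018_NQP_not_subset_ACC0_of_components` — the same from the layer below
  (Thm. 1.2 for `AC⁰[m]`, Thm. 5.1, glue), through
  `MurrayWilliams2018_NTIME_not_depth_ACC_of_components`.

Hence the trust base of `¬ (NQP ⊆ ACC0)` along the printed proof is
`{MurrayWilliams2018_thm_1_2_acc, MurrayWilliams2018_thm_5_1, NTIME_powLog_subset_NQP}`.

Addendum (discharge). The companion clock file `QuasiPolyClock.lean` has since PROVED the glue
inclusion (`NTIME_pow_log_pow_subset_NQP`, via a verified clock program for `n^{(log₂ n)ᵉ}` and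
the truncating wrapper); the last section of this file records the discharge
`NTIME_powLog_subset_NQP_holds` and the resulting reductions WITHOUT the glue hypothesis:
`MurrayWilliams2018_NQP_not_subset_ACC0_of_thm_1_3` (from the printed Thm. 1.3 alone) and
`MurrayWilliams2018_NQP_not_subset_ACC0_of_thm_1_2_5_1` (from Thm. 1.2 for `AC⁰[m]` and
Thm. 5.1), so that the trust base along the printed proof is now
`{MurrayWilliams2018_thm_1_2_acc, MurrayWilliams2018_thm_5_1}`.

## References

* C. D. Murray, R. R. Williams, *Circuit lower bounds for nondeterministic quasi-polytime: an easy
  witness lemma for NP and NQP*, STOC 2018, 890–901 (ECCC TR17-188), §1.1, Thm. 1.3, §5 (proof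
  of Thm. 1.1: `EVAL-GATE`) [MurrayWilliams2018].
* R. Williams, *Nonuniform ACC circuit lower bounds*, J. ACM 61 (2014), Lemma 5.1 (CIRCUIT-EVAL
  and `P ⊆ ACC`) [Williams2014].
* S. Arora, B. Barak, *Computational Complexity: A Modern Approach*, CUP 2009, Claim 2.4,
  §2.1.2 / Thm. 2.6, Thm. 6.18 [AroraBarak2009].
-/

namespace Literature.Computability.Complexity

open Classes Polynomial CircEval

/-! ### Pinning: `P ⊆ ACC⁰` puts all of `P/poly` into ONE `AC⁰_d[m]` -/

/-- **Pinning lemma** (Williams 2014, Lemma 5.1, sharp form of its proof: "If `P` has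
non-uniform `C` circuits … then … every `T(n)`-size circuit family has an equivalent …-size
circuit family in `C`", obtained from the `C`-circuits of the single problem CIRCUIT-EVAL; here
`C = ACC` and polynomial size). If `P ⊆ ACC⁰` then there are ONE modulus `m ≥ 2` and ONE depth `d`
such that every `L ∈ P/poly` has a depth-`d`, polynomial-size `AC⁰[m]`-circuit family: take the
depth-`d₀`, size-`q` `AC⁰[m]` circuits of `CircEval.EvalLang ∈ P` (`CircuitEval.lean`) and
hard-wire the description `desc Cₙ` of the `n`-th `B₂`-circuit of `L` (`Circuit.exists_hardwire`:
depth `d₀ + 1`, size `q(2n + 2 + |desc Cₙ|) + 2`). [cite: Williams2014, Lemma 5.1] -/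
theorem exists_pinned_of_P_subset_ACC0 (hP : Classes.P ⊆ ACC0) :
    ∃ m : ℕ, 2 ≤ m ∧ ∃ d : ℕ, ∀ L ∈ PPoly, ∃ r : Polynomial ℕ,
      L ∈ DepthSizeClass (accBasis m) (fun _ => d) (fun n => r.eval n) := by
  classical
  have hE : EvalLang ∈ ACC0 := hP EvalLang_mem_P
  simp only [ACC0, Set.mem_iUnion] at hE
  obtain ⟨m, hm, d, q, C, hC, hdec⟩ := hE
  refine ⟨m, hm, d + 1, fun L hL => ?_⟩
  simp only [PPoly, Set.mem_iUnion] at hL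
  obtain ⟨p, F, hF, hFdec⟩ := hL
  have har : ∀ n, ∀ g ∈ (F n).gates, g.arity ≤ 2 := fun n g hg => (hF n).1 g hg
  -- the advice: the description of the `n`-th circuit, of polynomial length `pa`
  let a : ℕ → List Bool := fun n => desc (F n)
  let pa : Polynomial ℕ := (p + 1) * (8 * (X + p) + 10)
  have hpa : ∀ n, (a n).length ≤ pa.eval n := by
    intro n
    refine (length_desc_le (F n)).trans ?_
    have hs : (F n).size ≤ p.eval n := (hF n).2
    simp only [pa, eval_mul, eval_add, eval_one, eval_X, eval_ofNat]
    exact Nat.mul_le_mul (by omega) (by omega)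
  have hLa : ∀ x, x ∈ L ↔ boolPair x (a x.length) ∈ EvalLang := by
    intro x
    change x ∈ L ↔ evalFn (boolPair x (desc (F x.length))) = [true]
    rw [evalFn_boolPair_desc x (F x.length) (har x.length), hFdec x, List.cons.injEq]
    simp only [and_true]
    exact Set.mem_iff_boolIndicator L x
  -- hard-wiring the advice into the circuits of `EvalLang`
  have hqmono : ∀ {x y : ℕ}, x ≤ y → q.eval x ≤ q.eval y := fun h => natPoly_eval_mono q h
  let Np : Polynomial ℕ := 2 * X + 2 + pa
  let r : Polynomial ℕ := q.comp Np + 2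
  have hr : ∀ n, r.eval n = q.eval (2 * n + 2 + pa.eval n) + 2 := by
    intro n
    simp [r, Np, eval_comp]
  have main : ∀ n : ℕ, ∃ D : Circuit (Fin n), D.IsOver (accBasis m) ∧ D.acDepth ≤ d + 1 ∧
      D.size ≤ r.eval n ∧ ∀ u : Fin n → Bool, D.eval u = L.boolIndicator (List.ofFn u) := by
    intro n
    let σ : Fin (2 * n + 2 + (a n).length) → Fin n ⊕ Bool :=
      Fin.append (Fin.append (fun i : Fin (2 * n) => Sum.inl ⟨(i : ℕ) / 2, by have := i.2; omega⟩)
        ![Sum.inr false, Sum.inr true]) (fun j => Sum.inr ((a n).get j))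
    obtain ⟨D, hDB, hDs, hDd, hDe⟩ := Circuit.exists_hardwire (B := accBasis m)
      (acBasis_subset_accBasis m (or_mem_acBasis 0)) (acBasis_subset_accBasis m (and_mem_acBasis 0))
      (C (2 * n + 2 + (a n).length)) (hC _).1 σ
    refine ⟨D, hDB, hDd.trans (Nat.add_le_add_right (hC (2 * n + 2 + (a n).length)).2.1 1),
      hDs.trans ?_, fun u => ?_⟩
    · rw [hr n]
      have h1 : 2 * n + 2 + (a n).length ≤ 2 * n + 2 + pa.eval n := by have := hpa n; omega
      have h2 := hqmono h1
      have h3 : (C (2 * n + 2 + (a n).length)).size ≤ q.eval (2 * n + 2 + (a n).length) :=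
        (hC (2 * n + 2 + (a n).length)).2.2
      omega
    · rw [hDe u]
      have hσ : (fun j => Sum.elim u id (σ j)) = pairVec u (a n).get := by
        funext j
        refine Fin.addCases (fun j₁ => ?_) (fun j₂ => ?_) j
        · refine Fin.addCases (fun i => ?_) (fun t => ?_) j₁
          · simp [σ, pairVec, Fin.append_left]
          · simp only [σ, pairVec, Fin.append_left, Fin.append_right]
            fin_cases t <;> rfl
        · simp [σ, pairVec, Fin.append_right]
      rw [hσ, hdec.eval_eq, ofFn_pairVec, List.ofFn_get]
      exact (boolIndicator_eq_of_iff ((hLa (List.ofFn u)).trans (by rw [List.length_ofFn]))).symm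
  choose D hD using main
  exact ⟨r, D, fun n => ⟨(hD n).1, (hD n).2.1, (hD n).2.2.1⟩, fun x => by
    have := (hD x.length).2.2.2 x.get
    rwa [List.ofFn_get] at this⟩

/-- Under `P ⊆ ACC⁰`, every `L ∈ P/poly` is, for the pinned `(m, d)`, in the depth-`d` `AC⁰[m]`
class with any quasi-polynomial size bound `c * n ^ log₂ n + c`, `c` large (every polynomial is
eventually below `n ^ log₂ n`, `natPoly_exists_eval_le_pow_log`). [cite: Williams2014, Lemma 5.1] -/
theorem exists_pinned_powLog_of_P_subset_ACC0 (hP : Classes.P ⊆ ACC0) :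
    ∃ m : ℕ, 2 ≤ m ∧ ∃ d : ℕ, ∀ L ∈ PPoly, ∃ c : ℕ,
      L ∈ DepthSizeClass (accBasis m) (fun _ => d) (fun n => c * n ^ Nat.log 2 n + c) := by
  obtain ⟨m, hm, d, h⟩ := exists_pinned_of_P_subset_ACC0 hP
  refine ⟨m, hm, d, fun L hL => ?_⟩
  obtain ⟨r, hr⟩ := h L hL
  obtain ⟨c, hc⟩ := natPoly_exists_eval_le_pow_log r
  exact ⟨c, DepthSizeClass_mono le_rfl (fun _ => le_rfl) hc hr⟩

/-! ### `P ⊆ NQP` -/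

/-- Every power is dominated by the quasi-polynomial `2^{(log₂ n)²}` up to an additive constant:
`n ^ K ≤ 2 ^ (log₂ n)² + (2 ^ (K + 1)) ^ K` (for `n ≥ 2 ^ (K + 1)` by `pow_le_two_pow_log_sq`,
smaller `n` by the constant). [folklore] -/
theorem pow_le_two_pow_log_sq_add (K n : ℕ) :
    n ^ K ≤ 2 ^ (Nat.log 2 n) ^ 2 + (2 ^ (K + 1)) ^ K := by
  by_cases h : 2 ^ (K + 1) ≤ n
  · exact (pow_le_two_pow_log_sq h).trans (Nat.le_add_right _ _)
  · exact (Nat.pow_le_pow_left (Nat.le_of_not_le h) K).trans (Nat.le_add_left _ _)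

/-- **`P ⊆ NTIME(2^{(log₂ n)²})`**: a polynomial-time decider is a verifier that discards its
certificate (Arora–Barak 2009, Claim 2.4; `DTIME_subset_NTIME_of_dominated`), and every
`p(n) + a nᵏ + a` is `≤ b · 2^{(log₂ n)²} + b`. [cite: AroraBarak2009, Claim 2.4] -/
theorem P_subset_NTIME_two_pow_log_sq :
    Classes.P ⊆ NTIME (fun n => 2 ^ (Nat.log 2 n) ^ 2) := by
  intro L hL
  simp only [Classes.P, Set.mem_iUnion] at hL
  obtain ⟨k, hk⟩ := hL
  refine DTIME_subset_NTIME_of_dominated (fun a p => ?_) hk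
  obtain ⟨c₁, k₁, h₁⟩ := exists_eval_le_mul_pow_add p
  set K := max k k₁ with hK
  set B := (2 ^ (K + 1)) ^ K with hB
  refine ⟨(c₁ + a) * B + 2 * (c₁ + a), fun n => ?_⟩
  have hpow : ∀ i, i ≤ K → n ^ i ≤ n ^ K + 1 := by
    intro i hi
    rcases Nat.eq_zero_or_pos n with rfl | hn
    · rcases Nat.eq_zero_or_pos i with rfl | hi0
      · simp
      · rw [zero_pow hi0.ne']; exact Nat.zero_le _
    · exact (Nat.pow_le_pow_right hn hi).trans (Nat.le_add_right _ _)
  have e₁ := hpow k (le_max_left _ _)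
  have e₂ := hpow k₁ (le_max_right _ _)
  have e₃ := pow_le_two_pow_log_sq_add K n
  have e₄ := h₁ n
  set Q := 2 ^ (Nat.log 2 n) ^ 2 with hQ
  have hB1 : 1 ≤ B := Nat.one_le_pow _ _ (Nat.two_pow_pos _)
  calc p.eval n + (a * n ^ k + a)
      ≤ (c₁ * (n ^ K + 1) + c₁) + (a * (n ^ K + 1) + a) := by
        gcongr
        · exact e₄.trans (by gcongr)
    _ = (c₁ + a) * n ^ K + 2 * (c₁ + a) := by ring
    _ ≤ (c₁ + a) * (Q + B) + 2 * (c₁ + a) := by gcongr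
    _ = (c₁ + a) * Q + ((c₁ + a) * B + 2 * (c₁ + a)) := by ring
    _ ≤ ((c₁ + a) * B + 2 * (c₁ + a)) * Q + ((c₁ + a) * B + 2 * (c₁ + a)) := by
        have h : c₁ + a ≤ (c₁ + a) * B + 2 * (c₁ + a) := by nlinarith [hB1]
        exact Nat.add_le_add_right (Nat.mul_le_mul_right _ h) _

/-- **`P ⊆ NQP`** (`P ⊆ NTIME(2^{(log₂ n)²})`, a level of `NQP`). [cite: AroraBarak2009, Claim 2.4] -/
theorem P_subset_NQP : Classes.P ⊆ NQP :=
  P_subset_NTIME_two_pow_log_sq.trans (NTIME_quasipoly_subset_NQP 2)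

/-! ### The headline from Theorem 1.3 -/

/-- **Glue fact**: `NTIME(n^{(log₂ n)ᵉ}) ⊆ NQP` for every `e` (folklore: `n^{(log₂ n)ᵉ} <
2^{(log₂ n + 1)(log₂ n)ᵉ} ≤ 2^{(log₂ n)^{e+2}}` for `log₂ n ≥ 2`, and nondeterministic time
classes are monotone in the bound, Arora–Barak 2009, §2.1.2 / Thm. 2.6). In the tree's
one-constant verifier form of `NTIME` (`Nondeterministic.lean`) the inclusion `NTIME t ⊆ NTIME t'`
for `t ≤ t'` is a machine construction (the verifier must cut witnesses at exactly
`c · t |x| + c`, which needs a clock machine for `t`; `NTIME_mono`, `NTIMEPadding.lean`), not yet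
carried out for `t n = n ^ (log₂ n) ^ e`; hence a named fact. [cite: AroraBarak2009, §2.1.2 and Thm. 2.6] -/
def NTIME_powLog_subset_NQP : Prop :=
  ∀ e : ℕ, NTIME (fun n => n ^ (Nat.log 2 n) ^ e) ⊆ NQP

/-- **`NQP ⊄ ACC⁰` from the printed Theorem 1.3** (Murray–Williams 2018, Thm. 1.3 and §1.1; the
quantifier swap by Williams 2014, Lemma 5.1). If `NQP ⊆ ACC⁰` then `P ⊆ NQP ⊆ ACC⁰`
(`P_subset_NQP`), so by pinning (`exists_pinned_powLog_of_P_subset_ACC0`) all of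
`P/poly ⊇ ACC⁰ ⊇ NQP` sits in depth-`d` `AC⁰[m]` of size `c * n ^ log₂ n + c` for ONE pair
`(d, m)`; but Thm. 1.3 at `(k, d, m) = (1, d, m)` provides `L ∈ NTIME(n^{(log₂ n)ᵉ}) ⊆ NQP`
(glue fact `NTIME_powLog_subset_NQP`) without such circuits for any `c`.
[cite: MurrayWilliams2018, Thm. 1.3 and §1.1] -/
theorem MurrayWilliams2018_NTIME_not_depth_ACC.not_subset_ACC0
    (h13 : MurrayWilliams2018_NTIME_not_depth_ACC) (hG : NTIME_powLog_subset_NQP) :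
    MurrayWilliams2018_NQP_not_subset_ACC0 := by
  intro hsub
  have hP : Classes.P ⊆ ACC0 := P_subset_NQP.trans hsub
  obtain ⟨m, hm, d, hpin⟩ := exists_pinned_powLog_of_P_subset_ACC0 hP
  obtain ⟨e, -, L, hL, hnot⟩ := h13 1 d m hm
  obtain ⟨c, hc⟩ := hpin L (ACC0_subset_PPoly (hsub (hG e hL)))
  exact hnot c (by simpa only [pow_one] using hc)

/-- The same assembly from the layer below: Thm. 1.2 for `AC⁰[m]`
(`MurrayWilliams2018_thm_1_2_acc`), the `ACC`-SAT algorithm Thm. 5.1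
(`MurrayWilliams2018_thm_5_1`) and the glue fact give `¬ (NQP ⊆ ACC0)`, through
`MurrayWilliams2018_NTIME_not_depth_ACC_of_components` (`MurrayWilliams2018.lean`).
[cite: MurrayWilliams2018, Thm. 1.3 and §1.1] -/
theorem MurrayWilliams2018_NQP_not_subset_ACC0_of_components (h12 : MurrayWilliams2018_thm_1_2_acc)
    (h51 : MurrayWilliams2018_thm_5_1) (hG : NTIME_powLog_subset_NQP) :
    MurrayWilliams2018_NQP_not_subset_ACC0 :=
  (MurrayWilliams2018_NTIME_not_depth_ACC_of_components h12 h51).not_subset_ACC0 hG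

/-! ### Discharge of the glue fact; the headline from the printed theorems alone -/

/-- **Discharge of the glue fact `NTIME_powLog_subset_NQP`** (D-0014): the inclusion
`NTIME (n ^ (log₂ n) ^ e) ⊆ NQP` for every `e` is the theorem `NTIME_pow_log_pow_subset_NQP` of
`QuasiPolyClock.lean` (a verified quasi-polynomial clock program and the truncating wrapper
`truncMapAux`, landing in the level `e + 2` of `NQP`). [cite: AroraBarak2009, §2.1.2 and Thm. 2.6] -/
theorem NTIME_powLog_subset_NQP_holds : NTIME_powLog_subset_NQP :=
  fun e => NTIME_pow_log_pow_subset_NQP e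

/-- **`NQP ⊄ ACC⁰` from the printed Theorem 1.3 alone** (Murray–Williams 2018, Thm. 1.3 and
§1.1): `MurrayWilliams2018_NTIME_not_depth_ACC → MurrayWilliams2018_NQP_not_subset_ACC0`, the
glue hypothesis of `MurrayWilliams2018_NTIME_not_depth_ACC.not_subset_ACC0` being discharged by
`NTIME_powLog_subset_NQP_holds`. [cite: MurrayWilliams2018, Thm. 1.3 and §1.1] -/
theorem MurrayWilliams2018_NQP_not_subset_ACC0_of_thm_1_3
    (h13 : MurrayWilliams2018_NTIME_not_depth_ACC) : MurrayWilliams2018_NQP_not_subset_ACC0 :=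
  h13.not_subset_ACC0 NTIME_powLog_subset_NQP_holds

/-- **`NQP ⊄ ACC⁰` from Theorem 1.2 (for `AC⁰[m]`) and Theorem 5.1 alone** (Murray–Williams
2018, §5: Thm. 1.3 from Thm. 1.2 and the `ACC ∘ THR`-SAT algorithm, then §1.1): the trust base of
the headline along the printed proof is `{MurrayWilliams2018_thm_1_2_acc,
MurrayWilliams2018_thm_5_1}`. [cite: MurrayWilliams2018, Thm. 1.3 and §1.1] -/
theorem MurrayWilliams2018_NQP_not_subset_ACC0_of_thm_1_2_5_1 (h12 : MurrayWilliams2018_thm_1_2_acc)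
    (h51 : MurrayWilliams2018_thm_5_1) : MurrayWilliams2018_NQP_not_subset_ACC0 :=
  MurrayWilliams2018_NQP_not_subset_ACC0_of_components h12 h51 NTIME_powLog_subset_NQP_holds

end Literature.Computability.Complexity
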